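import Literature.AlgebraicGeometry.HodgeTheory.WeilSurfaceCMSquare
import Literature.AlgebraicGeometry.HodgeTheory.AbelianVarietyEndomorphismsHOne
import Literature.AlgebraicGeometry.Motives.AbelianVarietyCohomologyExteriorH1
import Literature.AlgebraicGeometry.Motives.AbelianVarietyProjectiveChart
import HarnessLib

/-!
# Crux `HodgeAbelianVarieties` (stmt-HodgeConjecture-1333), line `cm-pivot-andre` — helper W3: the eigenvalues of a CM-typing endomorphism on `H¹` are non-real

In the CM typing `IsCM[A]` of the crux lines, an endomorphism `ψ : A ⟶ A` of a complex abelian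
variety `A` is given whose pull-back `ψ^*` on `H := H¹(A(ℂ); ℂ)` (of dimension `2 dim A`,
`AbelianVariety.finrank_complexBetti_one`) has `2 dim A` DISTINCT eigenvalues `μ i`. This file proves
that all the `μ i` are NON-REAL (`im_ne_zero_of_hasEigenvalue_of_injective`, the registered helper
W3 of the lead's André construction, where the `μ i` become the Weil eigenvalues of the targets).

Proof (Hodge symmetry in weight one; Deligne, *Hodge cycles on abelian varieties*, §3–4; van Geemen,
LNM 1594, proof of Lemma 5.2):

* `exists_eigenline_of_hasEigenvalue_of_injective` — `2 dim A` eigenvectors for the distinct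
  `μ j` are independent (`Module.End.eigenvectors_linearIndependent'`), hence a basis of `H`
  (`finrank H = 2 dim A`); expanding an eigenvector `c'` for `μ i` in it, the relation
  `(ψ^* - μ i) c' = Σ_j r_j (μ_j - μ_i) v_j = 0` kills every coordinate `j ≠ i`: each eigenspace is
  the LINE `ℂ v_i`.
* Purity (tree: `isOfHodgeType_one_or_of_eigenvector`, Voisin I §7.3.2 + Cor. 6.14): an eigenvector
  spanning its eigenline in `H¹` is of Hodge type `(1,0)` or `(0,1)`.
* Complex conjugation `conj` of `H¹(A(ℂ); ℂ) = H¹(A(ℂ); ℝ) ⊗ ℂ` (`conjClass`) commutes with `ψ^*`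
  (`conjClass_map`) and is conjugate-linear (`conjClass_smul`), so for a REAL `μ i` the class
  `conj v_i` is again an eigenvector for `μ i`, i.e. `conj v_i = t • v_i`; but `conj` exchanges the
  types `(1,0)` and `(0,1)` (`IsOfHodgeType.conjClass`, Voisin I Cor. 6.12), so `v_i` would be of
  both types, hence `0` (`eq_zero_of_isOfHodgeType_one_zero_of_zero_one`) — or `t = 0`, `conj v_i = 0`,
  `v_i = 0` (`conj` is an involution) —, contradicting `v_i ≠ 0`.

Everything is proved from tree theorems (`AbelianVariety.isSmoothProjective_holds`,
`finite_complexBetti_abelianVariety`, `AbelianVariety.finrank_complexBetti_one`, the conjugation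
calculus of `ComplexConjugation` / `HodgeTypeConjugation` and the purity lemma of
`WeilSurfaceCMSquare`); no definition, no named fact.

## References

* [Deligne1982HodgeCycles] P. Deligne, Hodge cycles on abelian varieties, LNM 900 (1982), §3–§4.
* [vanGeemen1994HodgeAV] B. van Geemen, An introduction to the Hodge conjecture for abelian
  varieties, LNM 1594 (1994), proof of Lemma 5.2.
* [VoisinHodgeI2002] C. Voisin, Hodge Theory and Complex Algebraic Geometry I (2002), Cor. 6.12,
  Cor. 6.14, §7.3.2.
-/

set_option linter.dupNamespace false

noncomputable section

namespace Summit.HodgeConjecture.HodgeConjecture.Theorems.HodgeAbelianVarieties.CMPivotAndre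

open CategoryTheory
open Literature.AlgebraicGeometry Literature.AlgebraicGeometry.Motives Literature.AlgebraicGeometry.HodgeTheory
open Literature.AlgebraicTopology.SingularHomology

/-- **Eigenspaces of a CM-typing endomorphism on `H¹` are lines.** For `ψ : A ⟶ A` whose pull-back
`ψ^*` on `H¹(A(ℂ); ℂ)` has the `2 dim A` distinct eigenvalues `μ j`, each eigenspace is spanned by
ONE non-zero eigenvector: eigenvectors `v j` for the `μ j` are linearly independent
(`Module.End.eigenvectors_linearIndependent'`), so — `dim H¹ = 2 dim A`
(`AbelianVariety.finrank_complexBetti_one`) — they span, and for an eigenvector `c' = Σ r_j v_j` of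
`μ i` the relation `Σ_j r_j (μ_j - μ_i) v_j = ψ^* c' - μ_i c' = 0` forces `r_j = 0` for `j ≠ i`.
[cite: Deligne1982HodgeCycles, §3] [folklore] -/
theorem exists_eigenline_of_hasEigenvalue_of_injective (A : AbelianVariety ℂ) (ψ : A ⟶ A)
    (μ : Fin (2 * A.dim) → ℂ) (hμ : Function.Injective μ)
    (hμe : ∀ i, Module.End.HasEigenvalue (complexBetti.map ψ.hom.hom.hom 1).hom (μ i))
    (i : Fin (2 * A.dim)) :
    ∃ c : complexBetti A.X 1, c ≠ 0 ∧ (complexBetti.map ψ.hom.hom.hom 1).hom c = μ i • c ∧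
      ∀ c' : complexBetti A.X 1, (complexBetti.map ψ.hom.hom.hom 1).hom c' = μ i • c' →
        ∃ t : ℂ, c' = t • c := by
  haveI := finite_complexBetti_abelianVariety A 1
  set T := (complexBetti.map ψ.hom.hom.hom 1).hom with hT
  choose v hv using fun j ↦ (hμe j).exists_hasEigenvector
  have hli : LinearIndependent ℂ v := Module.End.eigenvectors_linearIndependent' T μ hμ v hv
  have hspan : Submodule.span ℂ (Set.range v) = ⊤ :=
    hli.span_eq_top_of_card_eq_finrank'
      (by rw [Fintype.card_fin, AbelianVariety.finrank_complexBetti_one])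
  refine ⟨v i, (hv i).2, (hv i).apply_eq_smul, fun c' hc' ↦ ?_⟩
  have hmem : c' ∈ Submodule.span ℂ (Set.range v) := by rw [hspan]; exact Submodule.mem_top
  obtain ⟨r, hr⟩ := (Submodule.mem_span_range_iff_exists_fun ℂ).1 hmem
  -- the relation `Σ_j r_j (μ_j - μ_i) v_j = T c' - μ_i c' = 0`
  have hrel : ∑ j, (r j * (μ j - μ i)) • v j = 0 := by
    have h1 : T c' = ∑ j, (r j * μ j) • v j := by
      rw [← hr, map_sum]
      refine Finset.sum_congr rfl fun j _ ↦ ?_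
      rw [map_smul, (hv j).apply_eq_smul, smul_smul]
    have h2 : μ i • c' = ∑ j, (r j * μ i) • v j := by
      rw [← hr, Finset.smul_sum]
      refine Finset.sum_congr rfl fun j _ ↦ ?_
      rw [smul_smul, mul_comm]
    calc ∑ j, (r j * (μ j - μ i)) • v j = ∑ j, ((r j * μ j) • v j - (r j * μ i) • v j) :=
          Finset.sum_congr rfl fun j _ ↦ by rw [mul_sub, sub_smul]
      _ = T c' - μ i • c' := by rw [Finset.sum_sub_distrib, h1, h2]
      _ = 0 := by rw [hc', sub_self]
  have hzero : ∀ j, j ≠ i → r j = 0 := fun j hji ↦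
    (mul_eq_zero.1 (Fintype.linearIndependent_iff.1 hli _ hrel j)).resolve_right
      (sub_ne_zero.2 (hμ.ne hji))
  refine ⟨r i, ?_⟩
  rw [← hr, Finset.sum_eq_single i (fun j _ hji ↦ by rw [hzero j hji, zero_smul])
    (fun h ↦ absurd (Finset.mem_univ i) h)]

/-- **The eigenvalues of a CM-typing endomorphism on `H¹(A(ℂ); ℂ)` are non-real** (helper W3 of the
line `cm-pivot-andre`, registered signature verbatim): if `ψ : A ⟶ A` has `2 dim A` distinct
eigenvalues `μ i` on `H¹(A(ℂ); ℂ)`, then `Im (μ i) ≠ 0` for every `i`. Each eigenspace is a line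
`ℂ v_i` (`exists_eigenline_of_hasEigenvalue_of_injective`); `v_i` is of pure Hodge type `(1,0)` or
`(0,1)` (`isOfHodgeType_one_or_of_eigenvector`); for real `μ i`, `conj v_i` is an eigenvector for
`conj (μ i) = μ i` (`conjClass_map`, `conjClass_smul`), so `conj v_i = t • v_i`, while `conj`
exchanges the types `(1,0)` and `(0,1)` (Hodge symmetry, `IsOfHodgeType.conjClass`): `v_i` is of both
types, hence zero (`eq_zero_of_isOfHodgeType_one_zero_of_zero_one`), or `conj v_i = 0`; either way
`v_i = 0`, a contradiction. (Deligne: the CM type `Φ` and its conjugate partition the embeddings —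
no eigencharacter of a CM endomorphism on `H¹` is real.)
[cite: Deligne1982HodgeCycles, §3–§4] [cite: VoisinHodgeI2002, Cor. 6.12 and Cor. 6.14] -/
theorem im_ne_zero_of_hasEigenvalue_of_injective : ∀ (A : Literature.AlgebraicGeometry.Motives.AbelianVariety ℂ) (ψ : A ⟶ A) (μ : Fin (2 * A.dim) → ℂ), Function.Injective μ → (∀ i, Module.End.HasEigenvalue (Literature.AlgebraicGeometry.HodgeTheory.complexBetti.map ψ.hom.hom.hom 1).hom (μ i)) → ∀ i, (μ i).im ≠ 0 := by
  intro A ψ μ hμ hμe i him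
  have hX : IsSmoothProjective A.dim A.X := AbelianVariety.isSmoothProjective_holds (A := A)
  obtain ⟨c, hc0, hc, hline⟩ := exists_eigenline_of_hasEigenvalue_of_injective A ψ μ hμ hμe i
  have hreal : starRingEnd ℂ (μ i) = μ i := Complex.conj_eq_iff_im.2 him
  -- `conj c` is again an eigenvector of `ψ^*` for the real eigenvalue `μ i`
  have hconj : (complexBetti.map ψ.hom.hom.hom 1).hom (conjClass (ComplexPoints A.X) 1 c) =
      μ i • conjClass (ComplexPoints A.X) 1 c := by
    change singularCohomology.map ℂ ℂ (AlgPoints.mapContinuous (L := ℂ) ψ.hom.hom.hom) 1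
      (conjClass (ComplexPoints A.X) 1 c) = _
    rw [← conjClass_map]
    change conjClass (ComplexPoints A.X) 1 ((complexBetti.map ψ.hom.hom.hom 1).hom c) = _
    rw [hc, conjClass_smul, hreal]
  obtain ⟨t, ht⟩ := hline _ hconj
  -- hence `c` of type `(p, q)` forces `c` of type `(q, p)`
  have key : ∀ {p q : ℕ}, IsOfHodgeType A.dim A.X 1 p q c → IsOfHodgeType A.dim A.X 1 q p c := by
    intro p q hpq
    have h' : IsOfHodgeType A.dim A.X 1 q p (conjClass (ComplexPoints A.X) 1 c) := hpq.conjClass hX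
    rw [ht] at h'
    by_cases ht0 : t = 0
    · exfalso
      apply hc0
      calc c = conjClass (ComplexPoints A.X) 1 (conjClass (ComplexPoints A.X) 1 c) :=
            (conjClass_conjClass c).symm
        _ = 0 := by rw [ht, ht0, zero_smul, conjClass_zero]
    · have h'' := h'.smul t⁻¹
      rwa [smul_smul, inv_mul_cancel₀ ht0, one_smul] at h''
  rcases isOfHodgeType_one_or_of_eigenvector hX ψ.hom.hom.hom (μ i) hc hline with h10 | h01
  · exact hc0 (eq_zero_of_isOfHodgeType_one_zero_of_zero_one hX h10 (key h10))
  · exact hc0 (eq_zero_of_isOfHodgeType_one_zero_of_zero_one hX (key h01) h01)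

end Summit.HodgeConjecture.HodgeConjecture.Theorems.HodgeAbelianVarieties.CMPivotAndre

end
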